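import Literature.MathematicalPhysics.QuantumLattice.GrassmannFlowIterationSplit
import HarnessLib

/-!
# The flow of majorants with geometric degree profile: the scalar recursion `D_{j+1} = e[D̃_j + (Λ_j + D̃_j) θ_j/(1-θ_j)]`

Topic `MathematicalPhysics/QuantumLattice`; the scalar bookkeeping of `GrassmannFlowIterationSplit.iterEffAction_splitFlow`.
The single-scale step outputs kernels with a GEOMETRIC profile in the degree (`ρ^{-m} × const`), so along the flow the
untracked part `H_j = V^{(j)} - L_j` is naturally majorised by `NH j m = D_j t_j^m` with `t_{j+1} = ρ_j^{-1}`; its field-weighted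
norm is then a finite geometric sum, `‖·‖_{h_j}[D_j t_j^{2·}] ≤ D̃_j := D_j/(1 - x_j²)`, `x_j = e²(κ_j + ρ_j) t_j < 1` (the ratio
of the field weight of slice `j` to the output weight of slice `j-1` — small when consecutive slices are well separated), and
the functional recursion of the split flow collapses to a recursion of REAL NUMBERS:
`θ_j = e α_j (Λ_j + D̃_j)/κ_j²` (`Λ_j ≥ ‖·‖_{h_j}[NL j]` the norm of the tracked part) and `D_{j+1} ≥ e[D̃_j + (Λ_j + D̃_j) θ_j/(1-θ_j)]`
(Benfatto–Giuliani–Mastropietro 2006, (2.77)–(2.80), (2.86)–(2.90); Gawȩdzki–Kupiainen 1985, §3 — the dimensional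
bookkeeping of an un-renormalised multiscale expansion, to be fed with the slice constants of the model).

* `normV_geometric_le` — (`‖·‖_h` is additive in the pinned norms, and)
  `‖·‖_h[D t^{2·}] ≤ D/(1 - (e²(κ+ρ)t)²)`;
* **`iterEffAction_splitFlow_geometric`** — under the Gram/charge hypotheses of `iterEffAction_splitFlow`, a tracked part
  `L j` with `‖·‖_{h_j}[NL j] ≤ Λ_j`, and real sequences `D, t` with `t (j+1) = (ρ j)⁻¹`, `‖V - L 0‖` pinned `≤ D_0 t_0^m`,
  `x_j < 1`, `θ_j < 1`, `D_{j+1} ≥ e[D̃_j + (Λ_j + D̃_j)θ_j/(1-θ_j)]` for `j < K`: for every `n ≤ K` the single-slice partition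
  functions are units, `V^{(n)}` is even without constant part, and `Σ_{Y : Y_p = w} ‖kernel (V^{(n)} - L n) m Y‖ ≤ D_n t_n^m`
  (`m ≥ 1`).

Everything is proved; no definition, no named fact.

## Sources

G. Benfatto, A. Giuliani, V. Mastropietro, Ann. Henri Poincaré 7 (2006) 809–898, (2.77)–(2.80), (2.86)–(2.90)
[`BenfattoGiulianiMastropietro2006`]; K. Gawȩdzki, A. Kupiainen, Comm. Math. Phys. 102 (1985) 1–30, §3
[`GawedzkiKupiainen1985GrossNeveu`].
-/

noncomputable section

namespace Literature.MathematicalPhysics.QuantumLattice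

open GrassmannAlgebra Finset Literature.Probability.LatticeModels
open scoped InnerProductSpace Nat

variable {𝕜 : Type*} [RCLike 𝕜] {Γ : Type*} [Fintype Γ] [DecidableEq Γ]

/-! ### The field-weighted norm of sums and of geometric profiles -/

omit [DecidableEq Γ] in
/-- `‖·‖_h` is additive in the pinned norms. [folklore] -/
private theorem normV_add (κ ρ : ℝ) (N₁ N₂ : ℕ → ℝ) :
    normV Γ κ ρ (fun m' => N₁ m' + N₂ m') = normV Γ κ ρ N₁ + normV Γ κ ρ N₂ := by
  simp only [normV, mul_add, sum_add_distrib]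

omit [DecidableEq Γ] in
/-- **The field-weighted norm of a geometric degree profile**: `‖·‖_h[m' ↦ D t^{2m'}] ≤ D/(1 - x²)`, `x = e²(κ+ρ)t < 1`
(a finite geometric sum bounded by the full series). [cite: BenfattoGiulianiMastropietro2006, (2.77)-(2.80)] -/
theorem normV_geometric_le {κ ρ t D : ℝ} (hκρ : 0 ≤ κ + ρ) (ht : 0 ≤ t) (hD : 0 ≤ D)
    (hx : Real.exp 2 * (κ + ρ) * t < 1) :
    normV Γ κ ρ (fun m' => D * t ^ (2 * m')) ≤ D / (1 - (Real.exp 2 * (κ + ρ) * t) ^ 2) := by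
  set x : ℝ := Real.exp 2 * (κ + ρ) * t with hxdef
  have hx0 : 0 ≤ x := by positivity
  have hx2 : x ^ 2 < 1 := by nlinarith
  have hx20 : 0 ≤ x ^ 2 := sq_nonneg x
  have hterm : ∀ m', (Real.exp 2 * (κ + ρ)) ^ (2 * m') * (D * t ^ (2 * m')) = D * (x ^ 2) ^ m' := by
    intro m'
    have hxm : (x ^ 2) ^ m' = (Real.exp 2 * (κ + ρ)) ^ (2 * m') * t ^ (2 * m') := by
      rw [← pow_mul, hxdef, mul_pow]
    rw [hxm]
    ring
  have hgeom : HasSum (fun m' : ℕ => D * (x ^ 2) ^ m') (D * (1 - x ^ 2)⁻¹) :=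
    (hasSum_geometric_of_lt_one hx20 hx2).mul_left D
  calc normV Γ κ ρ (fun m' => D * t ^ (2 * m'))
      = ∑ m' ∈ range (Fintype.card Γ / 2 + 1), D * (x ^ 2) ^ m' := sum_congr rfl fun m' _ => hterm m'
    _ ≤ D * (1 - x ^ 2)⁻¹ := sum_le_hasSum _ (fun m' _ => by positivity) hgeom
    _ = D / (1 - x ^ 2) := by rw [div_eq_mul_inv]

/-! ### The geometric flow of majorants -/

/-- **The split flow with geometric majorants** (scalar form of `iterEffAction_splitFlow`).  Slices `C j` charged for `q`
and in Gram form (`κ j`, `f j`, `g j`), row/column sums `≤ α j`, output weights `ρ j`; an even `V` without constant part; a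
tracked part `L j` (even, positive-degree kernels flowing linearly, pinned norms `≤ NL j`, field-weighted norm
`‖·‖_{h_j}[NL j] ≤ Λ j`); real sequences `D, t ≥ 0` with `t (j+1) = (ρ j)⁻¹`, the pinned norms of `V - L 0` at most
`D 0 · (t 0)^m`, and for every `j < K`, with `x_j = e²(κ_j + ρ_j) t_j`, `D̃_j = D_j/(1 - x_j²)`, `θ_j = e α_j (Λ_j + D̃_j)/κ_j²`:
`x_j < 1`, `θ_j < 1` and `D (j+1) ≥ e (D̃_j + (Λ_j + D̃_j) θ_j/(1 - θ_j))`.  Then for every `n ≤ K`: the single-slice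
partition functions below `n` are units, `V^{(n)} = iterEffAction C n V` is even without constant part, and
`Σ_{Y : Y_p = w} ‖kernel (V^{(n)} - L n) m Y‖ ≤ D_n t_n^m` for `m ≥ 1` — the un-renormalised multiscale expansion reduced to
a recursion of real numbers (Benfatto–Giuliani–Mastropietro 2006, (2.77)–(2.80), (2.86)–(2.90)).
[cite: BenfattoGiulianiMastropietro2006, (2.77)-(2.80) and (2.86)-(2.90)] -/
theorem iterEffAction_splitFlow_geometric {E : Type*} [NormedAddCommGroup E] [InnerProductSpace 𝕜 E]
    (q : Γ → Bool) (C : ℕ → Matrix Γ Γ 𝕜) (hC : ∀ j X Y, q X = q Y → C j X Y = 0)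
    (f g : ℕ → Γ → E) (κ : ℕ → ℝ) (hκ : ∀ j, 0 < κ j)
    (hf : ∀ j X, q X = true → ‖f j X‖ ≤ κ j) (hg : ∀ j Y, q Y = false → ‖g j Y‖ ≤ κ j)
    (hG : ∀ j X Y, q X = true → q Y = false → contr 𝕜 (C j) X Y = ⟪f j X, g j Y⟫_𝕜)
    (α : ℕ → ℝ) (hα : ∀ j, 0 < α j) (hrow : ∀ j X, ∑ Y, ‖C j X Y‖ ≤ α j) (hcol : ∀ j Y, ∑ X, ‖C j X Y‖ ≤ α j)
    (ρ : ℕ → ℝ) (hρ : ∀ j, 0 < ρ j)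
    (V : GrassmannAlgebra 𝕜 Γ) (hV : V ∈ evenPart 𝕜 Γ) (hV0 : constPart 𝕜 V = 0)
    (L : ℕ → GrassmannAlgebra 𝕜 Γ) (hL : ∀ j, L j ∈ evenPart 𝕜 Γ)
    (hLflow : ∀ j, ∀ m, 0 < m → ∀ Y : Fin m → Γ, kernel 𝕜 (gaussConv 𝕜 (C j) (L j)) m Y = kernel 𝕜 (L (j + 1)) m Y)
    (NL : ℕ → ℕ → ℝ) (hNL0 : ∀ j m, 0 ≤ NL j m)
    (hNL : ∀ (j m : ℕ) (p : Fin m) (w : Γ), ∑ Y ∈ univ.filter (fun Y : Fin m → Γ => Y p = w), ‖kernel 𝕜 (L j) m Y‖ ≤ NL j m)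
    (Λ : ℕ → ℝ) (hΛ : ∀ j, normV Γ (κ j) (ρ j) (fun m' => NL j (2 * m')) ≤ Λ j)
    (D t : ℕ → ℝ) (hD0 : ∀ j, 0 ≤ D j) (ht0 : ∀ j, 0 ≤ t j) (ht : ∀ j, t (j + 1) = (ρ j)⁻¹)
    (hNHV : ∀ (m : ℕ) (p : Fin m) (w : Γ),
      ∑ Y ∈ univ.filter (fun Y : Fin m → Γ => Y p = w), ‖kernel 𝕜 (V - L 0) m Y‖ ≤ D 0 * t 0 ^ m)
    (K : ℕ) (hx : ∀ j < K, Real.exp 2 * (κ j + ρ j) * t j < 1)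
    (hθ : ∀ j < K, Real.exp 1 * α j * (Λ j + D j / (1 - (Real.exp 2 * (κ j + ρ j) * t j) ^ 2)) / κ j ^ 2 < 1)
    (hstep : ∀ j < K,
      Real.exp 1 * (D j / (1 - (Real.exp 2 * (κ j + ρ j) * t j) ^ 2) +
        (Λ j + D j / (1 - (Real.exp 2 * (κ j + ρ j) * t j) ^ 2)) *
          (Real.exp 1 * α j * (Λ j + D j / (1 - (Real.exp 2 * (κ j + ρ j) * t j) ^ 2)) / κ j ^ 2) /
            (1 - Real.exp 1 * α j * (Λ j + D j / (1 - (Real.exp 2 * (κ j + ρ j) * t j) ^ 2)) / κ j ^ 2)) ≤ D (j + 1)) :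
    ∀ n ≤ K, (∀ j < n, IsUnit (effPartitionFn 𝕜 (C j) (iterEffAction 𝕜 C j V))) ∧
      iterEffAction 𝕜 C n V ∈ evenPart 𝕜 Γ ∧ constPart 𝕜 (iterEffAction 𝕜 C n V) = 0 ∧
      ∀ (m : ℕ), 0 < m → ∀ (p : Fin m) (w : Γ),
        ∑ Y ∈ univ.filter (fun Y : Fin m → Γ => Y p = w), ‖kernel 𝕜 (iterEffAction 𝕜 C n V - L n) m Y‖ ≤ D n * t n ^ m := by
  -- the geometric majorants and the scalar quantities
  set NH : ℕ → ℕ → ℝ := fun j m => D j * t j ^ m with hNH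
  have hNH0 : ∀ j m, 0 ≤ NH j m := fun j m => by rw [hNH]; exact mul_nonneg (hD0 j) (pow_nonneg (ht0 j) m)
  have hκρ : ∀ j, 0 ≤ κ j + ρ j := fun j => (add_pos (hκ j) (hρ j)).le
  -- `‖·‖_{h_j}[NH j] ≤ D̃_j` and `‖·‖_{h_j}[NL j + NH j] ≤ Λ_j + D̃_j`
  have hnH : ∀ j < K, normV Γ (κ j) (ρ j) (fun m' => NH j (2 * m')) ≤
      D j / (1 - (Real.exp 2 * (κ j + ρ j) * t j) ^ 2) := fun j hj => by
    simpa only [hNH] using normV_geometric_le (Γ := Γ) (hκρ j) (ht0 j) (hD0 j) (hx j hj)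
  have hnLH : ∀ j < K, normV Γ (κ j) (ρ j) (fun m' => NL j (2 * m') + NH j (2 * m')) ≤
      Λ j + D j / (1 - (Real.exp 2 * (κ j + ρ j) * t j) ^ 2) := fun j hj => by
    rw [normV_add]; exact add_le_add (hΛ j) (hnH j hj)
  have hnLH0 : ∀ j, 0 ≤ normV Γ (κ j) (ρ j) (fun m' => NL j (2 * m') + NH j (2 * m')) :=
    fun j => normV_nonneg (hκ j).le (hρ j).le fun m' => add_nonneg (hNL0 j _) (hNH0 j _)
  have hnH0' : ∀ j, 0 ≤ normV Γ (κ j) (ρ j) (fun m' => NH j (2 * m')) :=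
    fun j => normV_nonneg (hκ j).le (hρ j).le fun m' => hNH0 j _
  -- the true `θ` is below the scalar `θ_j`
  have hθtrue : ∀ j < K, Real.exp 1 * α j * normV Γ (κ j) (ρ j) (fun m' => NL j (2 * m') + NH j (2 * m')) / κ j ^ 2 ≤
      Real.exp 1 * α j * (Λ j + D j / (1 - (Real.exp 2 * (κ j + ρ j) * t j) ^ 2)) / κ j ^ 2 := fun j hj => by
    have := hnLH j hj
    have hκ2 : 0 < κ j ^ 2 := pow_pos (hκ j) 2
    have he : 0 < Real.exp 1 * α j := mul_pos (Real.exp_pos 1) (hα j)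
    exact div_le_div_of_nonneg_right (mul_le_mul_of_nonneg_left this he.le) hκ2.le
  refine iterEffAction_splitFlow q C hC f g κ hκ hf hg hG α hα hrow hcol ρ hρ V hV hV0 L hL hLflow NL NH hNL0 hNH0 hNL
    (fun m p w => by simpa only [hNH] using hNHV m p w) K (fun j hj => (hθtrue j hj).trans_lt (hθ j hj)) ?_
  -- the one-step inequality at the geometric majorant
  intro j hj m hm
  set θt : ℝ := Real.exp 1 * α j * normV Γ (κ j) (ρ j) (fun m' => NL j (2 * m') + NH j (2 * m')) / κ j ^ 2 with hθt
  set θs : ℝ := Real.exp 1 * α j * (Λ j + D j / (1 - (Real.exp 2 * (κ j + ρ j) * t j) ^ 2)) / κ j ^ 2 with hθs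
  set Dt : ℝ := D j / (1 - (Real.exp 2 * (κ j + ρ j) * t j) ^ 2) with hDt
  have hθt0 : 0 ≤ θt := by rw [hθt]; exact div_nonneg (mul_nonneg (mul_nonneg (Real.exp_pos 1).le (hα j).le) (hnLH0 j)) (sq_nonneg _)
  have hθts : θt ≤ θs := hθtrue j hj
  have hθs1 : θs < 1 := hθ j hj
  have hfrac : θt / (1 - θt) ≤ θs / (1 - θs) := by
    rw [div_le_div_iff₀ (by linarith) (by linarith)]
    nlinarith
  have hfrac0 : 0 ≤ θt / (1 - θt) := div_nonneg hθt0 (by linarith)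
  have hρm : 0 < (ρ j)⁻¹ ^ m := pow_pos (inv_pos.2 (hρ j)) m
  have hA : Real.exp 1 * normV Γ (κ j) (ρ j) (fun m' => NH j (2 * m')) ≤ Real.exp 1 * Dt :=
    mul_le_mul_of_nonneg_left (hnH j hj) (Real.exp_pos 1).le
  have hB : Real.exp 1 * normV Γ (κ j) (ρ j) (fun m' => NL j (2 * m') + NH j (2 * m')) * θt / (1 - θt) ≤
      Real.exp 1 * (Λ j + Dt) * (θs / (1 - θs)) := by
    rw [mul_div_assoc]
    exact mul_le_mul (mul_le_mul_of_nonneg_left (hnLH j hj) (Real.exp_pos 1).le) hfrac hfrac0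
      (mul_nonneg (Real.exp_pos 1).le ((hnLH0 j).trans (hnLH j hj)))
  have hDnext : Real.exp 1 * (Dt + (Λ j + Dt) * θs / (1 - θs)) ≤ D (j + 1) := by
    simpa only [hDt, hθs] using hstep j hj
  -- assemble
  have hgoal : (ρ j)⁻¹ ^ m * (Real.exp 1 * normV Γ (κ j) (ρ j) (fun m' => NH j (2 * m'))) +
      (ρ j)⁻¹ ^ m * (Real.exp 1 * normV Γ (κ j) (ρ j) (fun m' => NL j (2 * m') + NH j (2 * m'))) * θt / (1 - θt) ≤
      (ρ j)⁻¹ ^ m * D (j + 1) := by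
    have e1 : (ρ j)⁻¹ ^ m * (Real.exp 1 * normV Γ (κ j) (ρ j) (fun m' => NL j (2 * m') + NH j (2 * m'))) * θt / (1 - θt) =
        (ρ j)⁻¹ ^ m * (Real.exp 1 * normV Γ (κ j) (ρ j) (fun m' => NL j (2 * m') + NH j (2 * m')) * θt / (1 - θt)) := by
      ring
    rw [e1, ← mul_add]
    refine mul_le_mul_of_nonneg_left ((add_le_add hA hB).trans ?_) hρm.le
    calc Real.exp 1 * Dt + Real.exp 1 * (Λ j + Dt) * (θs / (1 - θs))
        = Real.exp 1 * (Dt + (Λ j + Dt) * θs / (1 - θs)) := by ring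
      _ ≤ D (j + 1) := hDnext
  calc _ ≤ (ρ j)⁻¹ ^ m * D (j + 1) := hgoal
    _ = NH (j + 1) m := by rw [hNH]; dsimp only; rw [ht j, mul_comm]

end Literature.MathematicalPhysics.QuantumLattice

end
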